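import Mathlib.LinearAlgebra.Basis.Basic
import Mathlib.LinearAlgebra.Basis.VectorSpace
import Mathlib.RingTheory.Ideal.Quotient.Operations
import Literature.Computability.AlgebraicComplexity.GroupAlgebraTensor
import Literature.Computability.AlgebraicComplexity.BorderRankRestriction
import HarnessLib

/-!
# Structure tensors of quotient algebras and subalgebras are restrictions

Topic `Literature/Computability/AlgebraicComplexity` (companion of `GroupAlgebraTensor.lean`, Part II: the
structure tensor `structureTensor b` of a `K`-algebra in a basis `b`, and
`structureTensor_restrictsTo_of_algEquiv` — isomorphic algebras have restriction-equivalent structure tensors).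
Everything here is PROVED.

* `structureTensor_restrictsTo_of_linearMaps` — the common mechanism: if linear maps `σ : B → A`, `τ : A → B`
  satisfy `b_{x'} b_{y'} = τ(σ(b_{x'}) σ(b_{y'}))` on the basis of `B`, then `T_A ≥ T_B` (restriction with the
  matrices of `τ` on the output and of `σ` on the two inputs).
* `structureTensor_restrictsTo_of_surjective` — **quotients**: for a surjective algebra map `f : A → B`
  (e.g. `B = A/I`), `T_A ≥ T_B` (`σ` = any linear section of `f` on the basis, `τ = f`); hence
  `R(T_B) ≤ R(T_A)` and `bR(T_B) ≤ bR(T_A)` (`tensorRank_structureTensor_le_of_surjective`,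
  `algBorderRank_structureTensor_le_of_surjective`).
* `structureTensor_restrictsTo_of_injective` — **subalgebras** (over a field): for an injective algebra map
  `g : B → A`, `T_A ≥ T_B` (`σ = g`, `τ` = any linear retraction); hence the same rank inequalities
  (`tensorRank_structureTensor_le_of_injective`, `algBorderRank_structureTensor_le_of_injective`).

These are the standard monotonicity facts "the multiplicative complexity / rank of a homomorphic image or of a
subalgebra is at most that of the algebra" (de Groote 1987, Ch. I; Bürgisser–Clausen–Shokrollahi 1997, §14.2 and
Ch. 17, where they drive the lower bounds for algebras via `A ↠ A/rad A ≅ ∏ M_{dᵢ}(K)`): in particular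
`R(T_A) ≥ R(T_{A/I})` for every two-sided ideal `I`, so the rank of any finite-dimensional algebra is at least that
of its largest simple (Wedderburn) block of `A/rad A`.

## References

* H. F. de Groote, *Lectures on the Complexity of Bilinear Problems*, LNCS 245, Springer 1987, Ch. I
  (quotients and subalgebras of algebras; restriction of bilinear maps).
* P. Bürgisser, M. Clausen, M. A. Shokrollahi, *Algebraic Complexity Theory*, Springer 1997, §14.2
  (restriction of bilinear maps, Rem. (14.28)), Ch. 17 (lower bounds for `R(A)` through `A/rad A`).
  [BurgisserClausenShokrollahi1997]
-/

noncomputable section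

open scoped BigOperators

namespace Literature.Computability.AlgebraicComplexity

universe u

variable {K : Type u}

/-! ## The common mechanism -/

section Mechanism

variable [CommSemiring K]

/-- **Sandwiching by linear maps.** Let `a`, `b` be bases of `K`-algebras `A`, `B` and let `σ : B →ₗ A`,
`τ : A →ₗ B` be LINEAR maps with `b_{x'} · b_{y'} = τ (σ b_{x'} · σ b_{y'})` for all basis vectors of `B`. Then the
structure tensor of `B` is the restriction `(P ⊗ Q ⊗ Q) T_A` with `Q` the matrix of `σ` and `P` that of `τ`
(expand `σ b_{x'}`, `σ b_{y'}` in the basis `a`, multiply with the structure constants of `A`, apply `τ`).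
[folklore] -/
theorem structureTensor_restrictsTo_of_linearMaps {A B : Type*} [Semiring A] [Algebra K A]
    [Semiring B] [Algebra K B] {ι ι' : Type*} [Fintype ι] (a : Module.Basis ι K A)
    (b : Module.Basis ι' K B) (σ : B →ₗ[K] A) (τ : A →ₗ[K] B)
    (h : ∀ x' y', b x' * b y' = τ (σ (b x') * σ (b y'))) :
    TensorRestrictsTo (structureTensor a) (structureTensor b) := by
  refine ⟨fun z' z => b.repr (τ (a z)) z', fun x' x => a.repr (σ (b x')) x,
    fun y' y => a.repr (σ (b y')) y, fun z' x' y' => ?_⟩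
  set Bx := a.repr (σ (b x')) with hBx
  set By := a.repr (σ (b y')) with hBy
  have hx : σ (b x') = ∑ x, Bx x • a x := (a.sum_repr _).symm
  have hy : σ (b y') = ∑ y, By y • a y := (a.sum_repr _).symm
  -- coordinates of the product `σ(b x') σ(b y')` in the basis `a`
  have key1 : ∀ z, a.repr (σ (b x') * σ (b y')) z =
      ∑ x, ∑ y, Bx x * By y * structureTensor a z x y := by
    intro z
    rw [hx, hy, Finset.sum_mul_sum, map_sum, Finsupp.finsetSum_apply]
    refine Finset.sum_congr rfl fun x _ => ?_
    rw [map_sum, Finsupp.finsetSum_apply]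
    refine Finset.sum_congr rfl fun y _ => ?_
    rw [smul_mul_smul_comm, map_smul, Finsupp.smul_apply, smul_eq_mul, structureTensor_apply]
  -- `b x' * b y' = τ (σ(b x') σ(b y'))`, expanded in the basis `a` and pushed through `τ`
  have hmul : b x' * b y' = ∑ z, a.repr (σ (b x') * σ (b y')) z • τ (a z) := by
    calc b x' * b y' = τ (σ (b x') * σ (b y')) := h x' y'
      _ = τ (∑ z, a.repr (σ (b x') * σ (b y')) z • a z) := by rw [a.sum_repr]
      _ = ∑ z, a.repr (σ (b x') * σ (b y')) z • τ (a z) := by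
        rw [map_sum]
        exact Finset.sum_congr rfl fun z _ => map_smul _ _ _
  rw [structureTensor_apply, hmul, map_sum, Finsupp.finsetSum_apply]
  refine Finset.sum_congr rfl fun z _ => ?_
  rw [map_smul, Finsupp.smul_apply, smul_eq_mul, key1, Finset.sum_mul]
  refine Finset.sum_congr rfl fun x _ => ?_
  rw [Finset.sum_mul]
  refine Finset.sum_congr rfl fun y _ => ?_
  beta_reduce
  ring

end Mechanism

/-! ## Quotients (homomorphic images) -/

section Quotient

variable [CommSemiring K]

/-- **The structure tensor of a homomorphic image is a restriction**: if `f : A →ₐ B` is surjective (e.g.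
`B = A/I`), then `T_A ≥ T_B` — choose preimages of the basis vectors of `B` (a linear section `σ` with
`f ∘ σ = id`); then `b_{x'} b_{y'} = f(σ b_{x'}) f(σ b_{y'}) = f(σ b_{x'} · σ b_{y'})`. [folklore] -/
theorem structureTensor_restrictsTo_of_surjective {A B : Type*} [Semiring A] [Algebra K A]
    [Semiring B] [Algebra K B] {ι ι' : Type*} [Fintype ι] (a : Module.Basis ι K A)
    (b : Module.Basis ι' K B) (f : A →ₐ[K] B) (hf : Function.Surjective f) :
    TensorRestrictsTo (structureTensor a) (structureTensor b) := by
  classical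
  -- a linear section of `f`, defined on the basis `b`
  let σ : B →ₗ[K] A := b.constr K fun j => Classical.choose (hf (b j))
  have hσ : ∀ j, f (σ (b j)) = b j := fun j => by
    simp only [σ, Module.Basis.constr_basis]
    exact Classical.choose_spec (hf (b j))
  refine structureTensor_restrictsTo_of_linearMaps a b σ f.toLinearMap fun x' y' => ?_
  rw [AlgHom.toLinearMap_apply, map_mul, hσ, hσ]

/-- `R(T_B) ≤ R(T_A)` for a homomorphic image `B` of `A` (any bases). [folklore] -/
theorem tensorRank_structureTensor_le_of_surjective {A B : Type*} [Semiring A] [Algebra K A]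
    [Semiring B] [Algebra K B] {ι ι' : Type*} [Fintype ι] [Fintype ι'] (a : Module.Basis ι K A)
    (b : Module.Basis ι' K B) (f : A →ₐ[K] B) (hf : Function.Surjective f) :
    tensorRank (structureTensor b) ≤ tensorRank (structureTensor a) :=
  (structureTensor_restrictsTo_of_surjective a b f hf).tensorRank_le

end Quotient

section QuotientBorder

variable [Field K]

/-- `bR(T_B) ≤ bR(T_A)` over `K[ε]` for a homomorphic image `B` of `A` (finite bases). [folklore] -/
theorem algBorderRank_structureTensor_le_of_surjective {A B : Type*} [Semiring A] [Algebra K A]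
    [Semiring B] [Algebra K B] {ι ι' : Type*} [Fintype ι] [Fintype ι'] [DecidableEq ι] [DecidableEq ι']
    (a : Module.Basis ι K A) (b : Module.Basis ι' K B) (f : A →ₐ[K] B) (hf : Function.Surjective f) :
    algBorderRank (structureTensor b) ≤ algBorderRank (structureTensor a) :=
  (structureTensor_restrictsTo_of_surjective a b f hf).algBorderRank_le

end QuotientBorder

/-! ## Subalgebras -/

section Subalgebra

variable [Field K]

/-- **The structure tensor of a subalgebra is a restriction** (over a field): if `g : B →ₐ A` is injective, then
`T_A ≥ T_B` — take `σ = g` and any linear retraction `τ` (`τ ∘ g = id`, which exists over a field); then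
`b_{x'} b_{y'} = τ(g(b_{x'} b_{y'})) = τ(g b_{x'} · g b_{y'})`. [folklore] -/
theorem structureTensor_restrictsTo_of_injective {A B : Type*} [Ring A] [Algebra K A]
    [Ring B] [Algebra K B] {ι ι' : Type*} [Fintype ι] (a : Module.Basis ι K A)
    (b : Module.Basis ι' K B) (g : B →ₐ[K] A) (hg : Function.Injective g) :
    TensorRestrictsTo (structureTensor a) (structureTensor b) := by
  obtain ⟨τ, hτ⟩ := g.toLinearMap.exists_leftInverse_of_injective (LinearMap.ker_eq_bot.mpr hg)
  have hτg : ∀ w : B, τ (g w) = w := fun w => by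
    have := LinearMap.congr_fun hτ w
    simpa using this
  refine structureTensor_restrictsTo_of_linearMaps a b g.toLinearMap τ fun x' y' => ?_
  rw [AlgHom.toLinearMap_apply, AlgHom.toLinearMap_apply, ← map_mul g (b x') (b y'), hτg]

/-- `R(T_B) ≤ R(T_A)` for a subalgebra `B ↪ A` over a field (any bases). [folklore] -/
theorem tensorRank_structureTensor_le_of_injective {A B : Type*} [Ring A] [Algebra K A]
    [Ring B] [Algebra K B] {ι ι' : Type*} [Fintype ι] [Fintype ι'] (a : Module.Basis ι K A)
    (b : Module.Basis ι' K B) (g : B →ₐ[K] A) (hg : Function.Injective g) :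
    tensorRank (structureTensor b) ≤ tensorRank (structureTensor a) :=
  (structureTensor_restrictsTo_of_injective a b g hg).tensorRank_le

/-- `bR(T_B) ≤ bR(T_A)` over `K[ε]` for a subalgebra `B ↪ A` over a field (finite bases). [folklore] -/
theorem algBorderRank_structureTensor_le_of_injective {A B : Type*} [Ring A] [Algebra K A]
    [Ring B] [Algebra K B] {ι ι' : Type*} [Fintype ι] [Fintype ι'] [DecidableEq ι] [DecidableEq ι']
    (a : Module.Basis ι K A) (b : Module.Basis ι' K B) (g : B →ₐ[K] A) (hg : Function.Injective g) :
    algBorderRank (structureTensor b) ≤ algBorderRank (structureTensor a) :=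
  (structureTensor_restrictsTo_of_injective a b g hg).algBorderRank_le

end Subalgebra

end Literature.Computability.AlgebraicComplexity

end
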